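import Summits.BirchSwinnertonDyer.BirchSwinnertonDyer.Theses.ResidualThetaTransportAtTwo
import Summits.BirchSwinnertonDyer.BirchSwinnertonDyer.Theorems.ResidualThetaTransportAtTwoRlfOfTwistedEventualLevelDescent
import Summits.BirchSwinnertonDyer.BirchSwinnertonDyer.Theorems.ResidualThetaTransportAtTwoRlfTwistedAmbientGeneric
import Summits.BirchSwinnertonDyer.BirchSwinnertonDyer.Theorems.ResidualThetaTransportAtTwoRlfTwistedUniformExponentAlt
import Summits.BirchSwinnertonDyer.BirchSwinnertonDyer.Theorems.ResidualThetaTransportAtTwoRlfSharpEigenFinite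
import HarnessLib

/-!
# Item 23110 `ResidualLambdaFormulaNegDiscAtTwo` BY NAME from PRINT {weak Leopoldt at `2`, Prop. 4.12} + (LIFT⁺₂) + the TWO NAMED
# inputs of road T's (R5'): the `±`-duality at `2` (H-PLUSDUAL) and the bounded exponent of the `u`-eigenclasses of `Sel♯` (H-FIN) —
# the leaf door of road T with (TCAS-K)_ev DISCHARGED by the lead's `TwistedPT.hlevEventual_two_of_plusDualAlt_of_eigen` (p660516)

Route `ResidualThetaTransportAtTwo` (RTT, crux r201, stmt-BirchSwinnertonDyer-23110) / `ThetaPartnerAtTwo` (TP2, aside r205). Seat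
`prover-bsd-wall-tp2-p2x` g12 LEAD, derived from w3 g12's (D') door `…RlfOfTwistedPlusDualDescentDoor` (p661485) by (a) re-keying `hdual` to the
FINAL binder form (alternating + non-degenerate Weil data, `…UniformExponentAlt` p663434) and (b) DISCHARGING `hfinE` by the theorem
`SharpEigen.finite_setOf_not_exists_uniformExponent_sharp_two` (p666639); `--supports stmt-BirchSwinnertonDyer-23110`. THEOREMS ONLY; LEAF file
(imports the route file and route-independent helpers only — a sibling of the (D)/(D') doors, not built on them).

* `rlf2_of_twistedPlusDualAltDescent` — (C'): the count `#R♯_{S₀}(E) = 2^{λ(X⁺) + Σ N_v d_v}` for ONE curve of ANY rank from (ii) `hH`,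
  (LIFT⁺₂) `hlift`, (H-PLUSDUAL) `hdual` and (H-FIN) `hfinE` — `rlf2_of_twistedEventualLevelDescent` (p659819) with its eventual-level
  twisted Cassels hypothesis `hlev` supplied by `TwistedPT.hlevEventual_two_of_plusDualAlt_of_eigen` (PT over `ℚ`, the Weil pairing,
  `E(ℚ_∞)[2^∞] = 0`, divisibility and unramifiedness discharged in-tree by the lead).
* `residualLambdaFormulaNegDiscAtTwo_of_print_of_twistedPlusDualAltLift` — (D'): (hWL) → (h412) → «for every (κ, γ, S₀, E) of the branch:
  ∃ B finite, ∀ odd u ∉ B, LIFT⁺₂(u) ∧ H-PLUSDUAL(u) ∧ H-FIN(u)» → **`Theses.ResidualThetaTransportAtTwo.ResidualLambdaFormulaNegDiscAtTwo`**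
  BY NAME (`c = 0`): choose `u` outside `B` and the finite exceptional set of `TwistedSurj.exists_twistedCoinv_H1Sigma_of_print` (ii),
  then `rlf2_of_twistedPlusDualAltDescent` (the proof of the (D) door p660161 verbatim, one level down);
* `residualLambdaFormulaNegDiscAtTwo_TP2_of_print_of_twistedPlusDualAltLift` — the same for the TP2 decl (identical text).

The binders `hdual` / `hfinE` are VERBATIM the `hdual` / `hfinE` binders of `TwistedPT.hlevEventual_two_of_plusDualAlt_of_eigen` at `ε = 1`
(with `hu : (2 : ℤ) ∣ u - 1` as there). STATE OF 23110 AFTER THIS FILE: every rank ⟸ PRINT {WL@2, Prop. 4.12} (route binders) +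
(LIFT⁺₂)(u) [= (R3) twisted `+`-local lift at `2` (this seat's `…RlfTwistedPlusLocShiftMod` / `…PlusLocShiftDatum`, unconditional) + a
Prop. 4.13-type surjectivity modulo `L⁺` over `ℚ`] + H-PLUSDUAL(u) [B. D. Kim 2007 Prop. 3.18 read at `2`, twisted, level `ℚ` — seat w2's
lane] + H-FIN(u) [Greenberg's finiteness of `S_{A_{−s}}(ℚ)` for a.e. `s` from the cotorsion of `X⁺` — the lead's lane], for generic odd `u`.
HONEST FRAMING: CONDITIONAL; closes nothing; 23110 is NOT proved; BSD is not proved by any of this.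
References: [GreenbergLNM1716] §4 Props. 4.12–4.14 (pp. 119–124); [GreenbergVatsal2000] §2 Prop. (2.1), (10); [BDKim2013] Thm. 1.1;
B. D. Kim, Compositio Math. 143 (2007), Props. 3.15–3.18.
-/

set_option autoImplicit false
set_option linter.dupNamespace false

noncomputable section

open scoped Classical NumberField AddSubgroup

open NumberField IsDedekindDomain Field

namespace Summit.BirchSwinnertonDyer.BirchSwinnertonDyer.Theorems.SignedEC.TwistedLocalDescent

open Literature.NumberTheory.EllipticCurves Literature.NumberTheory.GaloisRepresentations
  Literature.NumberTheory.GaloisCohomology WeierstrassCurve ZpExtension Literature.NumberTheory.EllipticCurves.Kobayashi2003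
  Literature.NumberTheory.EllipticCurves.GreenbergVatsal2000 Literature.NumberTheory.EllipticCurves.GreenbergSelmer
  Literature.NumberTheory.EllipticCurves.Rank1Residual

/-- **(C') `#R♯_{S₀}(E) = 2^{λ(X⁺) + Σ_{v ∈ S₀} N_v d_v(E, 2)}` for ONE curve of ANY rank, from (ii) + (LIFT⁺₂) + H-PLUSDUAL + H-FIN.**
`κ` cyclotomic with topological generator `γ`, `S₀ ∌ 2` finite containing the bad places, `E/ℚ` globally minimal good supersingular at `2`
with `a₂ = 0` and `Δ < 0`, `D` a `+` dual datum with `X⁺` finitely generated torsion and `μ = 0`, `u` odd with (ii) `hH`, (LIFT⁺₂) `hlift`,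
the `±`-duality at `2` `hdual` and the bounded exponent of the `u`-eigenclasses of `Sel♯` `hfinE`: the count of
`rlf2_of_twistedEventualLevelDescent`, its (TCAS-K)_ev input supplied by `TwistedPT.hlevEventual_two_of_plusDualAlt_of_eigen`.
[cite: GreenbergLNM1716, §4 Props. 4.12–4.14 (pp. 119–124)] [cite: GreenbergVatsal2000, §2 Prop. (2.1)] -/
theorem rlf2_of_twistedPlusDualAltDescent (κ : ZpExtension ℚ 2) (γ : Field.absoluteGaloisGroup ℚ) (hκ : κ.IsCyclotomic)
    (hγ : κ.IsTopGenerator γ) (S₀ : Finset (HeightOneSpectrum (𝓞 ℚ))) (hS2 : ∀ v ∈ S₀, ((2 : ℕ) : 𝓞 ℚ) ∉ v.asIdeal)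
    (E : WeierstrassCurve ℚ) [E.IsElliptic] [E.IsGloballyMinimal] (hss : GoodSS E 2) (ha2 : E.frobeniusTrace 2 = 0)
    (hΔ : E.Δ < 0)
    (hS : ∀ v : HeightOneSpectrum (𝓞 ℚ), ¬ E.HasGoodReductionAt v → v ∈ S₀)
    (D : SignedSelmerDualData E κ γ 1) [Module.Finite (IwasawaAlgebra 2) D.X]
    (hT : Module.IsTorsion (IwasawaAlgebra 2) D.X) (hmu : D.mu = 0)
    {u : ℤ} (hu : (2 : ℤ) ∣ u - 1)
    (hH : ∀ h ∈ unramifiedOutside κ.kerSubgroup ↥(E.geomPrimaryTorsion 2) 2 (↑S₀ : Set (HeightOneSpectrum (𝓞 ℚ))),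
      ∃ h' ∈ unramifiedOutside κ.kerSubgroup ↥(E.geomPrimaryTorsion 2) 2 (↑S₀ : Set (HeightOneSpectrum (𝓞 ℚ))),
        u • E.conjH1 2 κ.kerSubgroup γ h' - h' = h)
    (hlift : ∀ c ∈ unramifiedOutside κ.kerSubgroup ↥(E.geomPrimaryTorsion 2) 2 (↑S₀ : Set (HeightOneSpectrum (𝓞 ℚ))),
      u • E.conjH1 2 κ.kerSubgroup γ c - c ∈
        ⨅ (v : HeightOneSpectrum (𝓞 ℚ)) (_ : ((2 : ℕ) : 𝓞 ℚ) ∈ v.asIdeal) (σ : Field.absoluteGaloisGroup ℚ),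
          (localKummerOverOfEmb E 2 κ.kerSubgroup (closureEmb (K := ℚ) (v.adicCompletion ℚ))
            (⨆ n : ℕ, signedLocalPoints κ (v.adicCompletion ℚ) E 1 n)).comap (E.conjH1 2 κ.kerSubgroup σ) →
      ∃ c' ∈ unramifiedOutside κ.kerSubgroup ↥(E.geomPrimaryTorsion 2) 2 (↑S₀ : Set (HeightOneSpectrum (𝓞 ℚ))),
        u • E.conjH1 2 κ.kerSubgroup γ c' = c' ∧ c - c' ∈
          ⨅ (v : HeightOneSpectrum (𝓞 ℚ)) (_ : ((2 : ℕ) : 𝓞 ℚ) ∈ v.asIdeal) (σ : Field.absoluteGaloisGroup ℚ),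
            (localKummerOverOfEmb E 2 κ.kerSubgroup (closureEmb (K := ℚ) (v.adicCompletion ℚ))
              (⨆ n : ℕ, signedLocalPoints κ (v.adicCompletion ℚ) E 1 n)).comap (E.conjH1 2 κ.kerSubgroup σ))
    (hdual : ∀ (J : ℕ) (u' : ℤ) (hu' : (2 : ℤ) ∣ u' - 1) (huu' : ((2 : ℤ) ^ J) ∣ u * u' - 1)
      (e : E.geomTorsion ((2 ^ J : ℕ) : ℤ) → E.geomTorsion ((2 ^ J : ℕ) : ℤ) → AlgebraicClosure ℚ)
      (hμ : ∀ S T, e S T ^ (2 ^ J) = 1) (hadd₁ : ∀ S₁ S₂ T, e (S₁ + S₂) T = e S₁ T * e S₂ T)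
      (hadd₂ : ∀ S T₁ T₂, e S (T₁ + T₂) = e S T₁ * e S T₂)
      (hgal : ∀ (σ : absoluteGaloisGroup ℚ) (S T : E.geomTorsion ((2 ^ J : ℕ) : ℤ)), σ • e S T = e (σ • S) (σ • T))
      (halt : ∀ T, e T T = 1) (hnondeg : ∀ T, (∀ S, e S T = 1) → T = 0)
      [Finite (E.geomTorsion ((2 ^ J : ℕ) : ℤ))]
      (inv : LocalInvariants ℚ (2 ^ J)), inv.IsPerfect → inv.SumLocalTermEqZero → inv.UnramifiedOrthogonal →
      ∀ (v : HeightOneSpectrum (𝓞 ℚ)), ((2 : ℕ) : 𝓞 ℚ) ∈ v.asIdeal →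
      ∀ y' : galoisCohomology ((E.twistedTorsionGaloisModule 2 κ J u' hu').restrictField (v.adicCompletion ℚ)) 1,
        galoisCohomology.map ((E.twistedWeilDual 2 κ J hu hu' huu' e hμ hadd₁ hadd₂ hgal).restrictField (v.adicCompletion ℚ)) 1 y' ∈
            inv.dualLocalCondition (E.twistedTorsionGaloisModule 2 κ J u hu) (Sum.inr v)
              (E.twistedTorsionLocalKummer 2 κ J u hu (v.adicCompletion ℚ)
                (⨆ n : ℕ, signedLocalPoints κ (v.adicCompletion ℚ) E 1 n)) →
        y' ∈ E.twistedTorsionLocalKummer 2 κ J u' hu' (v.adicCompletion ℚ) (⨆ n : ℕ, signedLocalPoints κ (v.adicCompletion ℚ) E 1 n))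
    (hfinE : ∃ e : ℕ, ∀ c ∈ unramifiedOutside κ.kerSubgroup ↥(E.geomPrimaryTorsion 2) 2 (↑S₀ : Set (HeightOneSpectrum (𝓞 ℚ))) ⊓
        ⨅ (v : HeightOneSpectrum (𝓞 ℚ)) (_ : ((2 : ℕ) : 𝓞 ℚ) ∈ v.asIdeal) (σ : Field.absoluteGaloisGroup ℚ),
          (localKummerOverOfEmb E 2 κ.kerSubgroup (closureEmb (K := ℚ) (v.adicCompletion ℚ))
            (⨆ n : ℕ, signedLocalPoints κ (v.adicCompletion ℚ) E 1 n)).comap (E.conjH1 2 κ.kerSubgroup σ),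
      E.conjH1 2 κ.kerSubgroup γ c = u • c → 2 ^ e • c = 0) :
    {x : subgroupH1 κ.kerSubgroup ↥((↥(E.geomPrimaryTorsion 2))[(2 : ℤ)]) |
        x ∈ unramifiedOutside κ.kerSubgroup ↥((↥(E.geomPrimaryTorsion 2))[(2 : ℤ)]) 2
            (↑S₀ : Set (HeightOneSpectrum (𝓞 ℚ))) ∧
          (∀ (w : InfinitePlace ℚ) (σ : Field.absoluteGaloisGroup ℚ),
            Literature.NumberTheory.EllipticCurves.conjH1 κ.kerSubgroup ↥((↥(E.geomPrimaryTorsion 2))[(2 : ℤ)]) σ x ∈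
              GreenbergSelmer.infKer κ.kerSubgroup ↥((↥(E.geomPrimaryTorsion 2))[(2 : ℤ)]) w) ∧
          (∀ (v : HeightOneSpectrum (𝓞 ℚ)), ((2 : ℕ) : 𝓞 ℚ) ∈ v.asIdeal → ∀ σ : Field.absoluteGaloisGroup ℚ,
            E.conjH1 2 κ.kerSubgroup σ
                (pushH1 κ.kerSubgroup ((↥(E.geomPrimaryTorsion 2))[(2 : ℤ)]).subtype (SignedTransportAtTwo.subtype_torsionBy_smul E 2) x) ∈
              localKummerOverOfEmb E 2 κ.kerSubgroup (closureEmb (K := ℚ) (v.adicCompletion ℚ))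
                (⨆ n : ℕ, signedLocalPoints κ (v.adicCompletion ℚ) E 1 n))}.ncard =
      2 ^ (lambdaInvariant 2 D.X +
        ∑ v ∈ S₀, 2 ^ padicValNat 2 ((Rat.HeightOneSpectrum.natGenerator v ^ 2 - 1) / 8) * dMultiplicity E 2 v) :=
  rlf2_of_twistedEventualLevelDescent κ γ hκ hγ S₀ hS2 E hss ha2 hΔ hS D hT hmu (u := u) (by exact_mod_cast hu) hH hlift
    (fun J t ↦ TwistedPT.hlevEventual_two_of_plusDualAlt_of_eigen E hss S₀ κ hγ u hu 1 hS2 hS hdual hfinE J t)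

/-- **(D') Item 23110 BY NAME from print + (LIFT⁺₂) + H-PLUSDUAL + H-FIN for generic odd `u`.** Granted the routes' PUB binders weak
Leopoldt (`Greenberg1999.h1SigmaInfty_rank_eq_one`) and Prop. 4.12 (`Greenberg1999.prop412_noFiniteSubmodule_H1Sigma_of_rank_one`) BY NAME,
and — for every cyclotomic datum, every admissible `S₀` and every curve `E` of the branch — «(LIFT⁺₂)(u) ∧ H-PLUSDUAL(u) ∧ H-FIN(u) for all
odd `u` outside a finite set», the route decl `ResidualLambdaFormulaNegDiscAtTwo` holds with `c = 0`: choose `u` outside `B` and the finite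
exceptional set of (ii) (`TwistedSurj.exists_twistedCoinv_H1Sigma_of_print`), then `rlf2_of_twistedPlusDualAltDescent`. CONDITIONAL; closes nothing.
[cite: GreenbergLNM1716, §4 Props. 4.12–4.14 (pp. 119–124)] [cite: GreenbergVatsal2000, §2 Prop. (2.1) and (10)] [cite: BDKim2013, Thm. 1.1] -/
theorem residualLambdaFormulaNegDiscAtTwo_of_print_of_twistedPlusDualAltLift (hWL : Greenberg1999.h1SigmaInfty_rank_eq_one)
    (h412 : Greenberg1999.prop412_noFiniteSubmodule_H1Sigma_of_rank_one)
    (hTL : ∀ (κ : ZpExtension ℚ 2) (γ : Field.absoluteGaloisGroup ℚ), κ.IsCyclotomic → κ.IsTopGenerator γ →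
      ∀ (S₀ : Finset (HeightOneSpectrum (𝓞 ℚ))), (∀ v ∈ S₀, ((2 : ℕ) : 𝓞 ℚ) ∉ v.asIdeal) →
      ∀ (E : WeierstrassCurve ℚ) [E.IsElliptic] [E.IsGloballyMinimal], GoodSS E 2 → E.frobeniusTrace 2 = 0 → E.Δ < 0 →
        (∀ v : HeightOneSpectrum (𝓞 ℚ), ¬ E.HasGoodReductionAt v → v ∈ S₀) →
      ∃ B : Set ℤ, B.Finite ∧ ∀ u : ℤ, u ∉ B → ∀ hu : (2 : ℤ) ∣ u - 1,
        (∀ c ∈ unramifiedOutside κ.kerSubgroup ↥(E.geomPrimaryTorsion 2) 2 (↑S₀ : Set (HeightOneSpectrum (𝓞 ℚ))),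
      u • E.conjH1 2 κ.kerSubgroup γ c - c ∈
        ⨅ (v : HeightOneSpectrum (𝓞 ℚ)) (_ : ((2 : ℕ) : 𝓞 ℚ) ∈ v.asIdeal) (σ : Field.absoluteGaloisGroup ℚ),
          (localKummerOverOfEmb E 2 κ.kerSubgroup (closureEmb (K := ℚ) (v.adicCompletion ℚ))
            (⨆ n : ℕ, signedLocalPoints κ (v.adicCompletion ℚ) E 1 n)).comap (E.conjH1 2 κ.kerSubgroup σ) →
      ∃ c' ∈ unramifiedOutside κ.kerSubgroup ↥(E.geomPrimaryTorsion 2) 2 (↑S₀ : Set (HeightOneSpectrum (𝓞 ℚ))),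
        u • E.conjH1 2 κ.kerSubgroup γ c' = c' ∧ c - c' ∈
          ⨅ (v : HeightOneSpectrum (𝓞 ℚ)) (_ : ((2 : ℕ) : 𝓞 ℚ) ∈ v.asIdeal) (σ : Field.absoluteGaloisGroup ℚ),
            (localKummerOverOfEmb E 2 κ.kerSubgroup (closureEmb (K := ℚ) (v.adicCompletion ℚ))
              (⨆ n : ℕ, signedLocalPoints κ (v.adicCompletion ℚ) E 1 n)).comap (E.conjH1 2 κ.kerSubgroup σ)) ∧
        (∀ (J : ℕ) (u' : ℤ) (hu' : (2 : ℤ) ∣ u' - 1) (huu' : ((2 : ℤ) ^ J) ∣ u * u' - 1)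
      (e : E.geomTorsion ((2 ^ J : ℕ) : ℤ) → E.geomTorsion ((2 ^ J : ℕ) : ℤ) → AlgebraicClosure ℚ)
      (hμ : ∀ S T, e S T ^ (2 ^ J) = 1) (hadd₁ : ∀ S₁ S₂ T, e (S₁ + S₂) T = e S₁ T * e S₂ T)
      (hadd₂ : ∀ S T₁ T₂, e S (T₁ + T₂) = e S T₁ * e S T₂)
      (hgal : ∀ (σ : absoluteGaloisGroup ℚ) (S T : E.geomTorsion ((2 ^ J : ℕ) : ℤ)), σ • e S T = e (σ • S) (σ • T))
      (halt : ∀ T, e T T = 1) (hnondeg : ∀ T, (∀ S, e S T = 1) → T = 0)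
      [Finite (E.geomTorsion ((2 ^ J : ℕ) : ℤ))]
      (inv : LocalInvariants ℚ (2 ^ J)), inv.IsPerfect → inv.SumLocalTermEqZero → inv.UnramifiedOrthogonal →
      ∀ (v : HeightOneSpectrum (𝓞 ℚ)), ((2 : ℕ) : 𝓞 ℚ) ∈ v.asIdeal →
      ∀ y' : galoisCohomology ((E.twistedTorsionGaloisModule 2 κ J u' hu').restrictField (v.adicCompletion ℚ)) 1,
        galoisCohomology.map ((E.twistedWeilDual 2 κ J hu hu' huu' e hμ hadd₁ hadd₂ hgal).restrictField (v.adicCompletion ℚ)) 1 y' ∈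
            inv.dualLocalCondition (E.twistedTorsionGaloisModule 2 κ J u hu) (Sum.inr v)
              (E.twistedTorsionLocalKummer 2 κ J u hu (v.adicCompletion ℚ)
                (⨆ n : ℕ, signedLocalPoints κ (v.adicCompletion ℚ) E 1 n)) →
        y' ∈ E.twistedTorsionLocalKummer 2 κ J u' hu' (v.adicCompletion ℚ)
          (⨆ n : ℕ, signedLocalPoints κ (v.adicCompletion ℚ) E 1 n))) :
    Summit.BirchSwinnertonDyer.BirchSwinnertonDyer.Theses.ResidualThetaTransportAtTwo.ResidualLambdaFormulaNegDiscAtTwo := by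
  intro κ γ hκ hγ S₀ hS2
  refine ⟨0, fun E _ _ hss ha hΔ hS D _ hX hμ ↦ ?_⟩
  obtain ⟨B, hB, hTLu⟩ := hTL κ γ hκ hγ S₀ hS2 E hss ha hΔ hS
  have hgood : ∀ v : HeightOneSpectrum (𝓞 ℚ), v ∉ S₀ → ((2 : ℕ) : 𝓞 ℚ) ∉ v.asIdeal → E.HasGoodReductionAt v :=
    fun v hv _ ↦ by by_contra hng; exact hv (hS v hng)
  -- H-FIN is a theorem: enlarge `B` by the finite exceptional set of `SharpEigen.finite_setOf_not_exists_uniformExponent_sharp_two`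
  have hBfin := SharpEigen.finite_setOf_not_exists_uniformExponent_sharp_two E hΔ κ hκ hγ S₀ hS2 D hX
  obtain ⟨u, huB, hu, hH⟩ := TwistedSurj.exists_twistedCoinv_H1Sigma_of_print hWL h412 E 2 κ γ hκ hγ S₀ hgood _ (hB.union hBfin)
  rw [Set.mem_union, not_or] at huB
  have hu' : (2 : ℤ) ∣ u - 1 := by exact_mod_cast hu
  obtain ⟨hlift, hdual⟩ := hTLu u huB.1 hu'
  have hfinE := huB.2
  simp only [Set.mem_setOf_eq, not_and, not_not] at hfinE
  simpa only [Nat.add_zero] using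
    rlf2_of_twistedPlusDualAltDescent κ γ hκ hγ S₀ hS2 E hss ha hΔ hS D hX hμ hu' hH hlift hdual (hfinE hu')

/-- **The same for the TP2 decl** `Theses.ThetaPartnerAtTwo.ResidualLambdaFormulaNegDiscAtTwo` (identical text).
[cite: GreenbergLNM1716, §4 Props. 4.12–4.14 (pp. 119–124)] [cite: GreenbergVatsal2000, §2 Prop. (2.1) and (10)] -/
theorem residualLambdaFormulaNegDiscAtTwo_TP2_of_print_of_twistedPlusDualAltLift (hWL : Greenberg1999.h1SigmaInfty_rank_eq_one)
    (h412 : Greenberg1999.prop412_noFiniteSubmodule_H1Sigma_of_rank_one)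
    (hTL : ∀ (κ : ZpExtension ℚ 2) (γ : Field.absoluteGaloisGroup ℚ), κ.IsCyclotomic → κ.IsTopGenerator γ →
      ∀ (S₀ : Finset (HeightOneSpectrum (𝓞 ℚ))), (∀ v ∈ S₀, ((2 : ℕ) : 𝓞 ℚ) ∉ v.asIdeal) →
      ∀ (E : WeierstrassCurve ℚ) [E.IsElliptic] [E.IsGloballyMinimal], GoodSS E 2 → E.frobeniusTrace 2 = 0 → E.Δ < 0 →
        (∀ v : HeightOneSpectrum (𝓞 ℚ), ¬ E.HasGoodReductionAt v → v ∈ S₀) →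
      ∃ B : Set ℤ, B.Finite ∧ ∀ u : ℤ, u ∉ B → ∀ hu : (2 : ℤ) ∣ u - 1,
        (∀ c ∈ unramifiedOutside κ.kerSubgroup ↥(E.geomPrimaryTorsion 2) 2 (↑S₀ : Set (HeightOneSpectrum (𝓞 ℚ))),
      u • E.conjH1 2 κ.kerSubgroup γ c - c ∈
        ⨅ (v : HeightOneSpectrum (𝓞 ℚ)) (_ : ((2 : ℕ) : 𝓞 ℚ) ∈ v.asIdeal) (σ : Field.absoluteGaloisGroup ℚ),
          (localKummerOverOfEmb E 2 κ.kerSubgroup (closureEmb (K := ℚ) (v.adicCompletion ℚ))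
            (⨆ n : ℕ, signedLocalPoints κ (v.adicCompletion ℚ) E 1 n)).comap (E.conjH1 2 κ.kerSubgroup σ) →
      ∃ c' ∈ unramifiedOutside κ.kerSubgroup ↥(E.geomPrimaryTorsion 2) 2 (↑S₀ : Set (HeightOneSpectrum (𝓞 ℚ))),
        u • E.conjH1 2 κ.kerSubgroup γ c' = c' ∧ c - c' ∈
          ⨅ (v : HeightOneSpectrum (𝓞 ℚ)) (_ : ((2 : ℕ) : 𝓞 ℚ) ∈ v.asIdeal) (σ : Field.absoluteGaloisGroup ℚ),
            (localKummerOverOfEmb E 2 κ.kerSubgroup (closureEmb (K := ℚ) (v.adicCompletion ℚ))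
              (⨆ n : ℕ, signedLocalPoints κ (v.adicCompletion ℚ) E 1 n)).comap (E.conjH1 2 κ.kerSubgroup σ)) ∧
        (∀ (J : ℕ) (u' : ℤ) (hu' : (2 : ℤ) ∣ u' - 1) (huu' : ((2 : ℤ) ^ J) ∣ u * u' - 1)
      (e : E.geomTorsion ((2 ^ J : ℕ) : ℤ) → E.geomTorsion ((2 ^ J : ℕ) : ℤ) → AlgebraicClosure ℚ)
      (hμ : ∀ S T, e S T ^ (2 ^ J) = 1) (hadd₁ : ∀ S₁ S₂ T, e (S₁ + S₂) T = e S₁ T * e S₂ T)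
      (hadd₂ : ∀ S T₁ T₂, e S (T₁ + T₂) = e S T₁ * e S T₂)
      (hgal : ∀ (σ : absoluteGaloisGroup ℚ) (S T : E.geomTorsion ((2 ^ J : ℕ) : ℤ)), σ • e S T = e (σ • S) (σ • T))
      (halt : ∀ T, e T T = 1) (hnondeg : ∀ T, (∀ S, e S T = 1) → T = 0)
      [Finite (E.geomTorsion ((2 ^ J : ℕ) : ℤ))]
      (inv : LocalInvariants ℚ (2 ^ J)), inv.IsPerfect → inv.SumLocalTermEqZero → inv.UnramifiedOrthogonal →
      ∀ (v : HeightOneSpectrum (𝓞 ℚ)), ((2 : ℕ) : 𝓞 ℚ) ∈ v.asIdeal →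
      ∀ y' : galoisCohomology ((E.twistedTorsionGaloisModule 2 κ J u' hu').restrictField (v.adicCompletion ℚ)) 1,
        galoisCohomology.map ((E.twistedWeilDual 2 κ J hu hu' huu' e hμ hadd₁ hadd₂ hgal).restrictField (v.adicCompletion ℚ)) 1 y' ∈
            inv.dualLocalCondition (E.twistedTorsionGaloisModule 2 κ J u hu) (Sum.inr v)
              (E.twistedTorsionLocalKummer 2 κ J u hu (v.adicCompletion ℚ)
                (⨆ n : ℕ, signedLocalPoints κ (v.adicCompletion ℚ) E 1 n)) →
        y' ∈ E.twistedTorsionLocalKummer 2 κ J u' hu' (v.adicCompletion ℚ)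
          (⨆ n : ℕ, signedLocalPoints κ (v.adicCompletion ℚ) E 1 n))) :
    Summit.BirchSwinnertonDyer.BirchSwinnertonDyer.Theses.ThetaPartnerAtTwo.ResidualLambdaFormulaNegDiscAtTwo :=
  residualLambdaFormulaNegDiscAtTwo_of_print_of_twistedPlusDualAltLift hWL h412 hTL

end Summit.BirchSwinnertonDyer.BirchSwinnertonDyer.Theorems.SignedEC.TwistedLocalDescent

end

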